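import Summits.QuantumFields.BalabanUV.Beta.CombMixedT2EvenStoreyTorus

/-!
# `BalabanUV.Beta.CombMixedT2EvenStoreyTorusRow` — binder row D1 ∕ (C1), PART 33c: **(K2b) ON THE TORUS AT EVERY DEPTH ALONG ANY TORUS GAUGE FUNCTION — THE MATRIX
# RECURSION** (road FP's `hK2b n` LEFT side at every box `n`, leaf-03 K-BRIDGES-n, with the storeywise right side as a RECURSION over the depth):
# `Σ_b (Dλ)_b • ℳ^{(m+1)}_{b,β} = wM2 • Σ_{b₁,b₂ ∈ win β} ((Λ_m b₂ − Λ_m b₁)·h(β;b₁,b₂)) • (cL̃_m(b₁) ⊗ cL̃_m(b₂)) + Σ_{b ∈ win β} ℓ(β;b) • Σ_{b′} (Dλ)_{b′} • ℳ^{(m)}_{b′,b}`,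
# `Λ_m b := λ(ŵ(R_m b.2))` (the gauge function at the finest ROOT of the level-`m` block), `cL̃_m(b) f := Σ'_n compLin_m((f.2, ↑f.1+M∘n); b)`, `ℳ^{(m)}_{·,b}` the torus member of the
# depth-`m` even table at the window bond `b` (PART 33b's `hVl`) — PART 33b's indicator rows summed against `λ` and packaged on the `ff` block (PART 31d one composite up)

WHY (road FP's `hK2b n B lam β` is stated for every torus gauge function `lam`; PART 33b gives the indicator rows `δ_s`).  §6: `Σ_s δ_s(r)·λ s = λ(ŵ r)` (`sum_tdelta_mul`) on the top
coefficients, linearity of the row in the gauge variation (`sum_sum_Dlam_mul_eq`) on the left and on each lower family's row, finite-sum exchanges (31c `sum_push4 ∕ sum_push2`); the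
matrix form by `ext` + `Fintype.sum_prod_type`.

WHAT ([folklore] finite-sum ∕ `Matrix` bookkeeping BY NAME; no `def`, no `def … : Prop`, nothing cited, 0 sorry): `sum_sum_Dlam_mul_eq`, **`sum_Dlam_mul_perZ_dper_compMixedT2per_even_succ`**
(entrywise along `λ`, every depth), **`torus_compM2even_pureGauge_fst_fun_succ`** (the display above).
WHAT THIS IS NOT: not the unrolled closed form over all storeys (iterate down to PART 26 ∕ 31d); not the bridge to v6∕v7's `hK2b` shape with `Rs` (road `FP/TowerK2bStoreyBridge` over PART 34's
Ĉ-SPLIT); nothing of Bałaban's asserted, valued or discharged; 0 estimates; 0∕4 row-D1 binders (hW, hR, D1Tel, D1Rep); ROOT M‴ p325680 ∕ P5c ∕ D6 untouched; NOT (C1), NOT (T-ID), NOT D1,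
NEVER «G-an2-4 closed», NOT BetaPertH, NOT continuum, NOT Clay.

HONEST DEPENDENCY (page 1, mandatory): continuum YM on T⁴ ⇐ BetaPertH ∧ nine spine estimates (0/9 proved); BetaPertH ⇐ (D1) ∧ (D4) ∧ CAP+tail;
G-an2-4 gates asym, D1 and NE2/3/4.  HONEST FRAMING (cell contract, verbatim): «discharging `BetaPertH` makes Bałaban's UV stability UNCONDITIONAL —
a real constructive-QFT result; it is NOT the continuum limit and NOT the Clay problem.»  ABSOLUTE RULE (cell charter, verbatim): «No internally-minted
statement may enter as a cited fact. Every hypothesis is either kernel-proved in this package or a verbatim quotation of a PUBLISHED theorem with page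
reference. The manuscript(s) under audit are NOT citable for their own disputed steps — they are the thing under adjudication; programme-internal
(2001/route/tribunal) claims are never citable.»  Row D1 ∕ (C1) OWNER an2 (b2b-balaban-beta-an2) gen 71, 2026-08-28.  §6 = PART 31d §8's proof one composite up.  No existing file touched.
-/

noncomputable section

open scoped BigOperators

namespace Summit.QuantumFields.BalabanUV.Beta.CombMixedT2EvenStoreyTorusRow

open Finset Matrix
open Literature.MathematicalPhysics.QuantumFieldTheory
open Literature.MathematicalPhysics.QuantumFieldTheory.Balaban1983to89
open Literature.MathematicalPhysics.QuantumFieldTheory.Balaban1983to89.Beta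
open B4TorusKernel.MultiPeriod (translate)
open B6Lemma24Torus (pbox)
open ExpKernelCalculus (MKer)
open AffineAveraging (Site)
open AveragingContoursRooted (ctr ctrOff)
open OneStepResolventKernel (Fib)
open BalabanStepW2 (M2Of wM2)
open Summit.QuantumFields.BalabanUV.Beta.TameKernelCalculus (trK)
open Summit.QuantumFields.BalabanUV.Beta.BorderedHessian (sgnK)
open Summit.QuantumFields.BalabanUV.Beta.SymAveragingHessianCounts (symLinKerAt symHessKerAt)
open Summit.QuantumFields.BalabanUV.Beta.CompositeVertexKernelRec (offs compLinKer)
open Summit.QuantumFields.BalabanUV.Beta.CompositeOneShotJets (compMix)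
open Summit.QuantumFields.BalabanUV.Beta.FP.KernelPeriodisationFib (Idx perF perF_apply perZ)
open Summit.QuantumFields.BalabanUV.Beta.FP.KernelPeriodisationFibLoc (dper)
open Summit.QuantumFields.BalabanUV.Beta.FP.TorusGaugeCovariance (tdelta tgrad)
open Summit.QuantumFields.BalabanUV.Beta.FP.TorusGaugeCovariancePairing (sum_tdelta_mul wrapPt wrapPt_of_mem)
open Summit.QuantumFields.BalabanUV.Beta.CombMixedT2EvenStoreyTwoTorus (sum_push4 sum_push2)
open Summit.QuantumFields.BalabanUV.Beta.CombMixedT2EvenStoreyTorus (sum_tgrad_mul_perZ_dper_compMixedT2per_even_succ)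

variable {Lc : ℕ} [NeZero Lc]

/-! ## §6 Along a torus gauge FUNCTION at every depth; the matrix form of the recursion (road FP's `hK2b n` left side at every box) -/

section Row

variable {M M' : Fin (3 + 1) → ℕ} [∀ μ, NeZero (M μ)] [∀ μ, NeZero (M' μ)] (L₂ j m : ℕ) (ρ' : Fin (3 + 1)) (w : Site (3 + 1))
  {V : Fin (3 + 1) → Site (3 + 1) → MKer (3 + 1) (Fib 3)} {Vl : Fin (3 + 1) → Site (3 + 1) → Fin (3 + 1) → Site (3 + 1) → MKer (3 + 1) (Fib 3)}

omit [NeZero Lc] [∀ μ, NeZero (M μ)] [∀ μ, NeZero (M' μ)] in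
/-- [folklore] a row contracted with the variation `(Dλ)_{(u,κ)} = Σ_s tgrad M (u, inl κ) s·λ s` of a torus gauge FUNCTION is the superposition of the rows along the indicators. -/
theorem sum_sum_Dlam_mul_eq (P : ↥(pbox M) → Fin (3 + 1) → ℝ) (lam : ↥(pbox M) → ℝ) :
    (∑ u : ↥(pbox M), ∑ κ : Fin (3 + 1), (∑ s : ↥(pbox M), tgrad M (u, Sum.inl κ) s * lam s) * P u κ)
      = ∑ s : ↥(pbox M), lam s * ∑ u : ↥(pbox M), ∑ κ : Fin (3 + 1), tgrad M (u, Sum.inl κ) s * P u κ := by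
  simp only [Finset.mul_sum, Finset.sum_mul]
  exact (Finset.sum_congr rfl fun u _ => Finset.sum_comm).trans (Finset.sum_comm.trans
    (Finset.sum_congr rfl fun s _ => Finset.sum_congr rfl fun u _ => Finset.sum_congr rfl fun κ _ => by ring))

/-- [folklore] **`sum_Dlam_mul_perZ_dper_compMixedT2per_even_succ` — THE TORUS RECURSION ALONG ANY TORUS GAUGE FUNCTION, ENTRYWISE, EVERY DEPTH**
(`(Dλ)_{(u,κ)} := Σ_s tgrad M (u, inl κ) s·λ s`, `ŵ := wrapPt M`, `R_m v := Lc^m•v + Σ_{k<m} Lc^k•ρ_c`):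
`Σ_{u,κ} (Dλ)_{(u,κ)} · perZ M (dper M (V κ u)) x z (inl α) (inl γ) = wM2 · Σ⁴ (λ(ŵ(R_m(Lc•w+e₂))) − λ(ŵ(R_m(Lc•w+e₁))))·h·cL̃_m((α,x);b₁)·cL̃_m((γ,z);b₂)
 + Σ² ℓ(ρ′,w;b) · Σ_{u,κ′} (Dλ)_{(u,κ′)} · perZ M (dper M (Vl κ e κ′ u)) x z (inl α) (inl γ)` — PART 33b's indicator rows summed against `λ`. -/
theorem sum_Dlam_mul_perZ_dper_compMixedT2per_even_succ (hM : ∀ i, M i = Lc ^ (m + 1) * M' i)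
    (hV : V = fun κ u x z a c => ∑' n : Site (3 + 1),
      ((1 / 2 : ℝ) • (M2Of 3 L₂ (compMix (ctrOff (3 + 1) Lc) Lc (m + 1)) j κ u ρ' (translate M' w n)
          + sgnK (trK (M2Of 3 L₂ (compMix (ctrOff (3 + 1) Lc) Lc (m + 1)) j κ u ρ' (translate M' w n))))) x z a c)
    (hVl : ∀ (κ : Fin (3 + 1)) (e : Site (3 + 1)), Vl κ e = fun κ' u x z a c => ∑' n : Site (3 + 1),
      ((1 / 2 : ℝ) • (M2Of 3 L₂ (compMix (ctrOff (3 + 1) Lc) Lc m) j κ' u κ (translate (fun i => Lc * M' i) ((Lc : ℤ) • w + e) n)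
          + sgnK (trK (M2Of 3 L₂ (compMix (ctrOff (3 + 1) Lc) Lc m) j κ' u κ (translate (fun i => Lc * M' i) ((Lc : ℤ) • w + e) n))))) x z a c)
    (lam : ↥(pbox M) → ℝ) (x z : Site (3 + 1)) (α γ : Fin (3 + 1)) :
    ∑ u : ↥(pbox M), ∑ κ : Fin (3 + 1), (∑ s : ↥(pbox M), tgrad M (u, Sum.inl κ) s * lam s) * perZ M (dper M (V κ (u : Site (3 + 1)))) x z (Sum.inl α) (Sum.inl γ)
      = wM2 3 L₂ j * (∑ κ₁ : Fin (3 + 1), ∑ e₁ ∈ offs Lc, ∑ κ₂ : Fin (3 + 1), ∑ e₂ ∈ offs Lc,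
          (lam (wrapPt M (((Lc ^ m : ℕ) : ℤ) • ((Lc : ℤ) • w + e₂) + ∑ k ∈ Finset.range m, ((Lc ^ k : ℕ) : ℤ) • ctr 4 Lc))
              - lam (wrapPt M (((Lc ^ m : ℕ) : ℤ) • ((Lc : ℤ) • w + e₁) + ∑ k ∈ Finset.range m, ((Lc ^ k : ℕ) : ℤ) • ctr 4 Lc)))
            * symHessKerAt (ctr 4 Lc) Lc ρ' w (κ₁, (Lc : ℤ) • w + e₁) (κ₂, (Lc : ℤ) • w + e₂)
            * (∑' n : Site (3 + 1), compLinKer (fun _ => symLinKerAt (ctr 4 Lc) Lc) Lc m (α, translate M x n) (κ₁, (Lc : ℤ) • w + e₁))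
            * (∑' n : Site (3 + 1), compLinKer (fun _ => symLinKerAt (ctr 4 Lc) Lc) Lc m (γ, translate M z n) (κ₂, (Lc : ℤ) • w + e₂)))
        + ∑ κ : Fin (3 + 1), ∑ e ∈ offs Lc, symLinKerAt (ctr 4 Lc) Lc ρ' w (κ, (Lc : ℤ) • w + e)
            * ∑ u : ↥(pbox M), ∑ κ' : Fin (3 + 1), (∑ s : ↥(pbox M), tgrad M (u, Sum.inl κ') s * lam s)
                * perZ M (dper M (Vl κ e κ' (u : Site (3 + 1)))) x z (Sum.inl α) (Sum.inl γ) := by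
  rw [sum_sum_Dlam_mul_eq (fun u κ => perZ M (dper M (V κ (u : Site (3 + 1)))) x z (Sum.inl α) (Sum.inl γ)) lam,
    Finset.sum_congr rfl fun s _ => by rw [sum_tgrad_mul_perZ_dper_compMixedT2per_even_succ L₂ j m ρ' w hM hV hVl s x z α γ]]
  simp only [sum_sum_Dlam_mul_eq (fun u κ' => perZ M (dper M (Vl _ _ κ' (u : Site (3 + 1)))) x z (Sum.inl α) (Sum.inl γ)) lam]
  -- both sides are the same superposition: expand `λ(ŵ r) = Σ_s δ_s(r)·λ s` on the right
  rw [Finset.sum_congr rfl fun κ₁ _ => Finset.sum_congr rfl fun e₁ _ => Finset.sum_congr rfl fun κ₂ _ => Finset.sum_congr rfl fun e₂ _ =>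
      show (lam (wrapPt M (((Lc ^ m : ℕ) : ℤ) • ((Lc : ℤ) • w + e₂) + ∑ k ∈ Finset.range m, ((Lc ^ k : ℕ) : ℤ) • ctr 4 Lc))
              - lam (wrapPt M (((Lc ^ m : ℕ) : ℤ) • ((Lc : ℤ) • w + e₁) + ∑ k ∈ Finset.range m, ((Lc ^ k : ℕ) : ℤ) • ctr 4 Lc)))
            * symHessKerAt (ctr 4 Lc) Lc ρ' w (κ₁, (Lc : ℤ) • w + e₁) (κ₂, (Lc : ℤ) • w + e₂)
            * (∑' n : Site (3 + 1), compLinKer (fun _ => symLinKerAt (ctr 4 Lc) Lc) Lc m (α, translate M x n) (κ₁, (Lc : ℤ) • w + e₁))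
            * (∑' n : Site (3 + 1), compLinKer (fun _ => symLinKerAt (ctr 4 Lc) Lc) Lc m (γ, translate M z n) (κ₂, (Lc : ℤ) • w + e₂))
        = ∑ s : ↥(pbox M), lam s * ((tdelta M (((Lc ^ m : ℕ) : ℤ) • ((Lc : ℤ) • w + e₂) + ∑ k ∈ Finset.range m, ((Lc ^ k : ℕ) : ℤ) • ctr 4 Lc) s
              - tdelta M (((Lc ^ m : ℕ) : ℤ) • ((Lc : ℤ) • w + e₁) + ∑ k ∈ Finset.range m, ((Lc ^ k : ℕ) : ℤ) • ctr 4 Lc) s)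
            * symHessKerAt (ctr 4 Lc) Lc ρ' w (κ₁, (Lc : ℤ) • w + e₁) (κ₂, (Lc : ℤ) • w + e₂)
            * (∑' n : Site (3 + 1), compLinKer (fun _ => symLinKerAt (ctr 4 Lc) Lc) Lc m (α, translate M x n) (κ₁, (Lc : ℤ) • w + e₁))
            * (∑' n : Site (3 + 1), compLinKer (fun _ => symLinKerAt (ctr 4 Lc) Lc) Lc m (γ, translate M z n) (κ₂, (Lc : ℤ) • w + e₂))) by
        rw [← sum_tdelta_mul (M := M) (((Lc ^ m : ℕ) : ℤ) • ((Lc : ℤ) • w + e₂) + ∑ k ∈ Finset.range m, ((Lc ^ k : ℕ) : ℤ) • ctr 4 Lc) lam,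
          ← sum_tdelta_mul (M := M) (((Lc ^ m : ℕ) : ℤ) • ((Lc : ℤ) • w + e₁) + ∑ k ∈ Finset.range m, ((Lc ^ k : ℕ) : ℤ) • ctr 4 Lc) lam,
          ← Finset.sum_sub_distrib, Finset.sum_mul, Finset.sum_mul, Finset.sum_mul]
        exact Finset.sum_congr rfl fun s _ => by ring]
  simp only [Finset.mul_sum, mul_add, Finset.sum_add_distrib]
  rw [sum_push4 (Finset.univ : Finset ↥(pbox M)), sum_push2 (Finset.univ : Finset ↥(pbox M))]
  exact congrArg₂ (· + ·)
    (Finset.sum_congr rfl fun κ₁ _ => Finset.sum_congr rfl fun e₁ _ => Finset.sum_congr rfl fun κ₂ _ => Finset.sum_congr rfl fun e₂ _ =>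
      Finset.sum_congr rfl fun s _ => by ring)
    (Finset.sum_congr rfl fun κ _ => Finset.sum_congr rfl fun e _ => Finset.sum_congr rfl fun s _ => by ring)

/-- [folklore] **`torus_compM2even_pureGauge_fst_fun_succ` — (K2b) ON THE TORUS AT EVERY DEPTH, STOREYWISE, AS A MATRIX RECURSION ON THE `ff` BLOCK** (road FP's `hK2b n`
LEFT side at every box, leaf-03 K-BRIDGES-n): with `ℳ^{(m+1)}_{b,β} := (perF M (dper M (V b.2 ↑b.1)))|ff`, `ℳ^{(m)}_{b′,b} := (perF M (dper M (Vl b.1 b.2 b′.2 ↑b′.1)))|ff` (the depth-`m`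
member at the window bond `b = (κ, Lc•w+e)`), `(Dλ)_b := Σ_s tgrad M (b.1, inl b.2) s·λ s`, `Λ_m(e) := λ(ŵ(R_m(Lc•w+e)))`:
`Σ_b (Dλ)_b • ℳ^{(m+1)}_{b,β} = wM2 • Σ_{κ₁e₁κ₂e₂} ((Λ_m e₂ − Λ_m e₁)·h(β;b₁,b₂)) • (cL̃_m(b₁) ⊗ cL̃_m(b₂)) + Σ_{κ,e} ℓ(β;b) • Σ_{b′} (Dλ)_{b′} • ℳ^{(m)}_{b′,(κ,e)}`. -/
theorem torus_compM2even_pureGauge_fst_fun_succ (hM : ∀ i, M i = Lc ^ (m + 1) * M' i)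
    (hV : V = fun κ u x z a c => ∑' n : Site (3 + 1),
      ((1 / 2 : ℝ) • (M2Of 3 L₂ (compMix (ctrOff (3 + 1) Lc) Lc (m + 1)) j κ u ρ' (translate M' w n)
          + sgnK (trK (M2Of 3 L₂ (compMix (ctrOff (3 + 1) Lc) Lc (m + 1)) j κ u ρ' (translate M' w n))))) x z a c)
    (hVl : ∀ (κ : Fin (3 + 1)) (e : Site (3 + 1)), Vl κ e = fun κ' u x z a c => ∑' n : Site (3 + 1),
      ((1 / 2 : ℝ) • (M2Of 3 L₂ (compMix (ctrOff (3 + 1) Lc) Lc m) j κ' u κ (translate (fun i => Lc * M' i) ((Lc : ℤ) • w + e) n)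
          + sgnK (trK (M2Of 3 L₂ (compMix (ctrOff (3 + 1) Lc) Lc m) j κ' u κ (translate (fun i => Lc * M' i) ((Lc : ℤ) • w + e) n))))) x z a c)
    (lam : ↥(pbox M) → ℝ) :
    (∑ b : ↥(pbox M) × Fin (3 + 1), (∑ s : ↥(pbox M), tgrad M (b.1, Sum.inl b.2) s * lam s) •
        (perF M (dper M (V b.2 (b.1 : Site (3 + 1))))).submatrix
          (fun b : ↥(pbox M) × Fin (3 + 1) => ((b.1, Sum.inl b.2) : Idx M (Fib 3)))
          (fun b : ↥(pbox M) × Fin (3 + 1) => ((b.1, Sum.inl b.2) : Idx M (Fib 3))))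
      = wM2 3 L₂ j • (∑ κ₁ : Fin (3 + 1), ∑ e₁ ∈ offs Lc, ∑ κ₂ : Fin (3 + 1), ∑ e₂ ∈ offs Lc,
            ((lam (wrapPt M (((Lc ^ m : ℕ) : ℤ) • ((Lc : ℤ) • w + e₂) + ∑ k ∈ Finset.range m, ((Lc ^ k : ℕ) : ℤ) • ctr 4 Lc))
                - lam (wrapPt M (((Lc ^ m : ℕ) : ℤ) • ((Lc : ℤ) • w + e₁) + ∑ k ∈ Finset.range m, ((Lc ^ k : ℕ) : ℤ) • ctr 4 Lc)))
              * symHessKerAt (ctr 4 Lc) Lc ρ' w (κ₁, (Lc : ℤ) • w + e₁) (κ₂, (Lc : ℤ) • w + e₂))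
            • Matrix.vecMulVec
                (fun f : ↥(pbox M) × Fin (3 + 1) => ∑' n : Site (3 + 1),
                  compLinKer (fun _ => symLinKerAt (ctr 4 Lc) Lc) Lc m (f.2, translate M (f.1 : Site (3 + 1)) n) (κ₁, (Lc : ℤ) • w + e₁))
                (fun f : ↥(pbox M) × Fin (3 + 1) => ∑' n : Site (3 + 1),
                  compLinKer (fun _ => symLinKerAt (ctr 4 Lc) Lc) Lc m (f.2, translate M (f.1 : Site (3 + 1)) n) (κ₂, (Lc : ℤ) • w + e₂)))
        + ∑ κ : Fin (3 + 1), ∑ e ∈ offs Lc, symLinKerAt (ctr 4 Lc) Lc ρ' w (κ, (Lc : ℤ) • w + e) •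
            ∑ b' : ↥(pbox M) × Fin (3 + 1), (∑ s : ↥(pbox M), tgrad M (b'.1, Sum.inl b'.2) s * lam s) •
              (perF M (dper M (Vl κ e b'.2 (b'.1 : Site (3 + 1))))).submatrix
                (fun b : ↥(pbox M) × Fin (3 + 1) => ((b.1, Sum.inl b.2) : Idx M (Fib 3)))
                (fun b : ↥(pbox M) × Fin (3 + 1) => ((b.1, Sum.inl b.2) : Idx M (Fib 3))) := by
  ext f f'
  simp only [Matrix.sum_apply, Matrix.smul_apply, Matrix.add_apply, Matrix.vecMulVec_apply, Matrix.submatrix_apply, perF_apply, smul_eq_mul]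
  rw [Fintype.sum_prod_type, sum_Dlam_mul_perZ_dper_compMixedT2per_even_succ L₂ j m ρ' w hM hV hVl lam _ _ f.2 f'.2]
  simp only [Fintype.sum_prod_type]
  refine congrArg₂ (· + ·) ?_ rfl
  refine congrArg (fun t : ℝ => wM2 3 L₂ j * t) ?_
  exact Finset.sum_congr rfl fun κ₁ _ => Finset.sum_congr rfl fun e₁ _ => Finset.sum_congr rfl fun κ₂ _ => Finset.sum_congr rfl fun e₂ _ => by ring

end Row

end Summit.QuantumFields.BalabanUV.Beta.CombMixedT2EvenStoreyTorusRow

end
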